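import Summits.CriticalPhenomena.CardyFormulaZ2.Theorems.CardyComplexConeSLESixFamiliesGiveCardyCollarDomainsPart1

/-!
# Trapezoid profiles with plateaus (helper file 2 for `stub_collarDomains`)

Route `CardyComplexCone`, crux `SLESixFamiliesGiveCardy`, line `collar-touch-sandwich`, STUB E.
The profile of the comparison rectangles: `1 + h q` where `q` is the sum of two trapezoids with
plateaus, supported in two disjoint closed parameter windows `[a₁, b₁]`, `[a₂, b₂]` of the fundamental
window `[m, m + 1]` of a conformal rectangle and made `1`-periodic through that window (as `profile` in
`CollarDomain.lean`).  Proved here: continuity, periodicity, the bounds `0 ≤ q ≤ 1`, the support and the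
plateaus of `q`, the window representative `rep` of a parameter, and the resulting `Profile`
(`windowProfile`).
-/

noncomputable section

open Set Metric Topology Filter
open Literature.Probability.RandomPlanarGeometry

namespace Summit.CriticalPhenomena.CardyFormulaZ2.Cruxes.SLESixFamiliesGiveCardy.CollarTouchSandwich

/-! ### The trapezoid -/

/-- The trapezoid `max 0 (min 1 (min ((τ - a)/d) ((b - τ)/d)))`: for `d > 0` it is continuous, vanishes
off `(a, b)`, is positive on `(a, b)`, equals `1` on `[a + d, b - d]`, with values in `[0, 1]`. -/
def trapz (a b d τ : ℝ) : ℝ := max 0 (min 1 (min ((τ - a) / d) ((b - τ) / d)))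

/-- The trapezoid is continuous. -/
theorem continuous_trapz (a b d : ℝ) : Continuous (trapz a b d) := by
  unfold trapz; fun_prop

/-- The trapezoid is nonnegative. -/
theorem trapz_nonneg (a b d τ : ℝ) : 0 ≤ trapz a b d τ := le_max_left _ _

/-- The trapezoid is at most `1`. -/
theorem trapz_le_one (a b d τ : ℝ) : trapz a b d τ ≤ 1 :=
  max_le zero_le_one (min_le_left _ _)

/-- The trapezoid vanishes off `(a, b)`. -/
theorem trapz_eq_zero {a b d τ : ℝ} (hd : 0 < d) (h : τ ≤ a ∨ b ≤ τ) : trapz a b d τ = 0 := by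
  refine max_eq_left ((min_le_right _ _).trans ?_)
  rcases h with h | h
  · exact (min_le_left _ _).trans (div_nonpos_of_nonpos_of_nonneg (by linarith) hd.le)
  · exact (min_le_right _ _).trans (div_nonpos_of_nonpos_of_nonneg (by linarith) hd.le)

/-- The trapezoid is positive on `(a, b)`. -/
theorem trapz_pos {a b d τ : ℝ} (hd : 0 < d) (ha : a < τ) (hb : τ < b) : 0 < trapz a b d τ :=
  lt_max_of_lt_right (lt_min one_pos (lt_min (div_pos (by linarith) hd) (div_pos (by linarith) hd)))

/-- A positive trapezoid value forces `τ ∈ (a, b)`. -/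
theorem mem_Ioo_of_trapz_pos {a b d τ : ℝ} (hd : 0 < d) (h : 0 < trapz a b d τ) : τ ∈ Ioo a b := by
  by_contra hno
  rw [mem_Ioo, not_and_or, not_lt, not_lt] at hno
  rw [trapz_eq_zero hd hno] at h
  exact lt_irrefl _ h

/-- The trapezoid is `1` on the plateau `[a + d, b - d]`. -/
theorem trapz_eq_one {a b d τ : ℝ} (hd : 0 < d) (ha : a + d ≤ τ) (hb : τ ≤ b - d) : trapz a b d τ = 1 := by
  have h1 : 1 ≤ (τ - a) / d := by rw [le_div_iff₀ hd]; linarith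
  have h2 : 1 ≤ (b - τ) / d := by rw [le_div_iff₀ hd]; linarith
  rw [trapz, min_eq_left (le_min h1 h2), max_eq_right zero_le_one]

/-! ### Two windows -/

/-- **Window data**: a base point `m` (the first mark of the rectangle), two closed windows
`m < a₁ < b₁ < a₂ < b₂ < m + 1` and a ramp width `d > 0` with `2 d < bᵢ - aᵢ`. -/
structure Windows where
  /-- Base point of the fundamental window `[m, m + 1]`. -/
  m : ℝ
  /-- Left end of the first window. -/
  a₁ : ℝ
  /-- Right end of the first window. -/
  b₁ : ℝ
  /-- Left end of the second window. -/
  a₂ : ℝ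
  /-- Right end of the second window. -/
  b₂ : ℝ
  /-- Ramp width. -/
  d : ℝ
  /-- `m < a₁`. -/
  m_lt : m < a₁
  /-- `a₁ + 2d < b₁` (room for a plateau). -/
  a₁_lt : a₁ + 2 * d < b₁
  /-- `b₁ < a₂`. -/
  b₁_lt : b₁ < a₂
  /-- `a₂ + 2d < b₂`. -/
  a₂_lt : a₂ + 2 * d < b₂
  /-- `b₂ < m + 1`. -/
  b₂_lt : b₂ < m + 1
  /-- The ramp width is positive. -/
  d_pos : 0 < d

namespace Windows

variable (W : Windows)

/-- The window function: the sum of the two trapezoids. -/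
def qW (τ : ℝ) : ℝ := trapz W.a₁ W.b₁ W.d τ + trapz W.a₂ W.b₂ W.d τ

/-- The periodised window function `qW (m + fract (t - m))`. -/
def q (t : ℝ) : ℝ := W.qW (W.m + Int.fract (t - W.m))

/-- The window representative `m + fract (t - m) ∈ [m, m + 1)` of a parameter. -/
def rep (t : ℝ) : ℝ := W.m + Int.fract (t - W.m)

/-- The representative lies in the fundamental window. -/
theorem rep_mem (t : ℝ) : W.rep t ∈ Ico W.m (W.m + 1) :=
  ⟨by have := Int.fract_nonneg (t - W.m); rw [rep]; linarith,
    by have := Int.fract_lt_one (t - W.m); rw [rep]; linarith⟩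

/-- The representative differs from the parameter by an integer. -/
theorem rep_eq (t : ℝ) : W.rep t = t + ((-⌊t - W.m⌋ : ℤ) : ℝ) := by
  rw [rep, Int.fract]; push_cast; ring

/-- The representative of a point of the fundamental window is the point itself. -/
theorem rep_of_mem {t : ℝ} (ht : t ∈ Ico W.m (W.m + 1)) : W.rep t = t := by
  rw [rep, Int.fract_eq_self.2 ⟨by linarith [ht.1], by linarith [ht.2]⟩, add_sub_cancel]

/-- The representative of a point of the shifted window `[m + 1, m + 2)` is the point minus one. -/
theorem rep_of_mem_add_one {t : ℝ} (ht : t ∈ Ico (W.m + 1) (W.m + 2)) : W.rep t = t - 1 := by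
  have h : Int.fract (t - W.m) = t - W.m - 1 := by
    rw [Int.fract, show ⌊t - W.m⌋ = 1 from Int.floor_eq_iff.2 ⟨by push_cast; linarith [ht.1], by push_cast; linarith [ht.2]⟩]
    push_cast; ring
  rw [rep, h]; ring

/-- The representative of a point of the window `[m - 1, m)` is the point plus one. -/
theorem rep_of_mem_sub_one {t : ℝ} (ht : t ∈ Ico (W.m - 1) W.m) : W.rep t = t + 1 := by
  have h : Int.fract (t - W.m) = t - W.m + 1 := by
    rw [Int.fract, show ⌊t - W.m⌋ = -1 from Int.floor_eq_iff.2 ⟨by push_cast; linarith [ht.1], by push_cast; linarith [ht.2]⟩]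
    push_cast; ring
  rw [rep, h]; ring

/-- The periodised window function is the window function of the representative. -/
theorem q_eq (t : ℝ) : W.q t = W.qW (W.rep t) := rfl

/-- The window function vanishes at both ends of the fundamental window. -/
theorem qW_m : W.qW W.m = 0 ∧ W.qW (W.m + 1) = 0 := by
  have h1 := W.m_lt; have h2 := W.a₁_lt; have h3 := W.b₁_lt; have h4 := W.a₂_lt; have h5 := W.b₂_lt
  have hd := W.d_pos
  constructor <;> rw [qW, trapz_eq_zero hd, trapz_eq_zero hd, add_zero]
  · left; linarith
  · left; linarith
  · right; linarith
  · right; linarith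

/-- The window function is continuous. -/
theorem continuous_qW : Continuous W.qW := (continuous_trapz _ _ _).add (continuous_trapz _ _ _)

/-- **The periodised window function is continuous** (it vanishes at both ends of the window). -/
theorem continuous_q : Continuous W.q := by
  have hF : Continuous ((fun x => W.qW (W.m + x)) ∘ Int.fract) := by
    refine ContinuousOn.comp_fract'' (W.continuous_qW.comp (continuous_const.add continuous_id)).continuousOn ?_
    simp only [add_zero]
    rw [W.qW_m.1, W.qW_m.2]
  exact hF.comp (continuous_id.sub continuous_const)

/-- The periodised window function is `1`-periodic. -/
theorem periodic_q : Function.Periodic W.q 1 := fun t => by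
  simp only [q, show t + 1 - W.m = t - W.m + 1 by ring, Int.fract_add_one]

/-- At most one trapezoid is nonzero; the window function takes values in `[0, 1]`. -/
theorem qW_mem (τ : ℝ) : W.qW τ ∈ Icc (0 : ℝ) 1 := by
  have hd := W.d_pos
  refine ⟨add_nonneg (trapz_nonneg _ _ _ _) (trapz_nonneg _ _ _ _), ?_⟩
  rw [qW]
  rcases le_or_gt τ W.b₁ with h | h
  · rw [trapz_eq_zero hd (Or.inl (h.trans W.b₁_lt.le) : τ ≤ W.a₂ ∨ W.b₂ ≤ τ), add_zero]; exact trapz_le_one _ _ _ _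
  · rw [trapz_eq_zero hd (Or.inr h.le), zero_add]; exact trapz_le_one _ _ _ _

/-- The periodised window function takes values in `[0, 1]`. -/
theorem q_mem (t : ℝ) : W.q t ∈ Icc (0 : ℝ) 1 := W.qW_mem _

/-- **Support of the window function**: it is positive exactly on the two open windows. -/
theorem qW_pos_iff (τ : ℝ) : 0 < W.qW τ ↔ τ ∈ Ioo W.a₁ W.b₁ ∨ τ ∈ Ioo W.a₂ W.b₂ := by
  have hd := W.d_pos
  constructor
  · intro h
    by_contra hno
    rw [not_or] at hno
    have h1 : trapz W.a₁ W.b₁ W.d τ = 0 := by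
      by_contra hne
      exact hno.1 (mem_Ioo_of_trapz_pos hd (lt_of_le_of_ne (trapz_nonneg _ _ _ _) (Ne.symm hne)))
    have h2 : trapz W.a₂ W.b₂ W.d τ = 0 := by
      by_contra hne
      exact hno.2 (mem_Ioo_of_trapz_pos hd (lt_of_le_of_ne (trapz_nonneg _ _ _ _) (Ne.symm hne)))
    rw [qW, h1, h2, add_zero] at h
    exact lt_irrefl _ h
  · rintro (h | h)
    · exact add_pos_of_pos_of_nonneg (trapz_pos hd h.1 h.2) (trapz_nonneg _ _ _ _)
    · exact add_pos_of_nonneg_of_pos (trapz_nonneg _ _ _ _) (trapz_pos hd h.1 h.2)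

/-- Off the two open windows the window function vanishes. -/
theorem qW_eq_zero {τ : ℝ} (h : τ ∉ Ioo W.a₁ W.b₁) (h' : τ ∉ Ioo W.a₂ W.b₂) : W.qW τ = 0 := by
  have h0 := (W.qW_mem τ).1
  by_contra hne
  rcases (W.qW_pos_iff τ).1 (lt_of_le_of_ne h0 (Ne.symm hne)) with h1 | h1
  · exact h h1
  · exact h' h1

/-- **Plateaus**: the window function is `1` on `[a₁ + d, b₁ - d]` and on `[a₂ + d, b₂ - d]`. -/
theorem qW_eq_one {τ : ℝ} (h : τ ∈ Icc (W.a₁ + W.d) (W.b₁ - W.d) ∨ τ ∈ Icc (W.a₂ + W.d) (W.b₂ - W.d)) : W.qW τ = 1 := by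
  have hd := W.d_pos
  rcases h with h | h
  · rw [qW, trapz_eq_one hd h.1 h.2, trapz_eq_zero hd (Or.inl (by linarith [h.2, W.b₁_lt]) : τ ≤ W.a₂ ∨ W.b₂ ≤ τ), add_zero]
  · rw [qW, trapz_eq_zero hd (Or.inr (by linarith [h.1, W.b₁_lt]) : τ ≤ W.a₁ ∨ W.b₁ ≤ τ), trapz_eq_one hd h.1 h.2, zero_add]

/-! ### The profile `1 + h q` -/

/-- **The window profile** `1 + h q` of width `0 < h ≤ 1/2`, as a `Profile`. -/
def profile {h : ℝ} (hh : 0 < h) (hh1 : h ≤ 1 / 2) : Profile where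
  p t := 1 + h * W.q t
  h := h
  continuous := continuous_const.add (continuous_const.mul W.continuous_q)
  periodic t := by simp only [W.periodic_q t]
  pos := hh
  le_half := hh1
  lower t := by have := (W.q_mem t).1; nlinarith
  upper t := by have := (W.q_mem t).2; nlinarith

/-- The window profile, unfolded. -/
@[simp] theorem profile_p {h : ℝ} (hh : 0 < h) (hh1 : h ≤ 1 / 2) (t : ℝ) : (W.profile hh hh1).p t = 1 + h * W.q t := rfl

/-- The width of the window profile. -/
@[simp] theorem profile_h {h : ℝ} (hh : 0 < h) (hh1 : h ≤ 1 / 2) : (W.profile hh hh1).h = h := rfl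

/-- The window profile is at least `1`. -/
theorem one_le_profile {h : ℝ} (hh : 0 < h) (hh1 : h ≤ 1 / 2) (t : ℝ) : 1 ≤ (W.profile hh hh1).p t := by
  rw [profile_p]; have := (W.q_mem t).1; nlinarith

/-- The window profile exceeds `1` exactly where `q > 0`, i.e. where the representative lies in an
open window. -/
theorem one_lt_profile_iff {h : ℝ} (hh : 0 < h) (hh1 : h ≤ 1 / 2) (t : ℝ) :
    1 < (W.profile hh hh1).p t ↔ W.rep t ∈ Ioo W.a₁ W.b₁ ∨ W.rep t ∈ Ioo W.a₂ W.b₂ := by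
  rw [profile_p, ← W.qW_pos_iff, q_eq]
  constructor
  · intro h1; nlinarith
  · intro h1; nlinarith

/-- The window profile is `1` exactly where the representative lies off the open windows. -/
theorem profile_eq_one_iff {h : ℝ} (hh : 0 < h) (hh1 : h ≤ 1 / 2) (t : ℝ) :
    (W.profile hh hh1).p t = 1 ↔ W.rep t ∉ Ioo W.a₁ W.b₁ ∧ W.rep t ∉ Ioo W.a₂ W.b₂ := by
  have h1 := W.one_le_profile hh hh1 t
  rw [← not_or, ← W.one_lt_profile_iff hh hh1 t, not_lt]
  exact ⟨fun h => h.le, fun h => le_antisymm h h1⟩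

/-- **On the plateaus the window profile is `1 + h`.** -/
theorem profile_eq_of_plateau {h : ℝ} (hh : 0 < h) (hh1 : h ≤ 1 / 2) {t : ℝ}
    (ht : W.rep t ∈ Icc (W.a₁ + W.d) (W.b₁ - W.d) ∨ W.rep t ∈ Icc (W.a₂ + W.d) (W.b₂ - W.d)) :
    (W.profile hh hh1).p t = 1 + h := by
  rw [profile_p, q_eq, W.qW_eq_one ht, mul_one]

end Windows

/-- **Main statement of this file** (registered helper stub, arrow style): on the plateaus the window
profile is `1 + h`. -/
theorem windowProfile_eq_of_plateau : ∀ (W : Windows) {h : ℝ} (hh : 0 < h) (hh1 : h ≤ 1 / 2) {t : ℝ}, (W.rep t ∈ Icc (W.a₁ + W.d) (W.b₁ - W.d) ∨ W.rep t ∈ Icc (W.a₂ + W.d) (W.b₂ - W.d)) → (W.profile hh hh1).p t = 1 + h :=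
  fun W _ hh hh1 _ ht => W.profile_eq_of_plateau hh hh1 ht

end Summit.CriticalPhenomena.CardyFormulaZ2.Cruxes.SLESixFamiliesGiveCardy.CollarTouchSandwich

end
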